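import Mathlib
import Literature.Algebra.EuclideanLattices.FccBccLattices
import Literature.MathematicalPhysics.StatisticalMechanics.HcpHomogeneous

/-!
# Rigidity of the radius-`5/2` cluster of hcp — stub `stub_keyRigidity`

Stub `stub_keyRigidity` of line `vanishing-excess-truss-rigidity` (crux `CoarseGrains`,
stmt-AtomisticToContinuum-9331).

For `(a, h)` in the box `47/50 ≤ a ≤ 1`, `39/50·a ≤ h ≤ 17/20·a` and a linear isometry `g` of `ℝ³`
mapping the radius-`5/2` cluster of `P = hcp(a,h)` into `P` and onto it, `g` maps `P` onto `P`.

Proof (no classification of the point group).  Let `L ⊂ P` be the even layers (a lattice,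
`P = L ∪ (b + L)`, `b = barlowPos 1 0 0`).  Parity trick: for `n ∈ P`, `2 n ∈ P` forces `n ∈ L`
(the second coordinate of an odd-layer point is `a√3/2 (j + 1/3)`, never half of `a√3/2 · j'`).
Hence the images `g u`, `g v` of the layer generators (norm `a ≤ 5/4`, so `2u, 2v` are still in
the cluster) lie in `L`; having norm `a < 2h` they lie in layer `0`, i.e. in the plane `x₂ = 0`.
A `2 × 2` Gram/Lagrange identity shows `g u`, `g v` span that plane, so `g (h e₃) = ± h e₃`, and
`g (i u + j v + 2k' h e₃) ∈ L`: `g L ⊆ L`, whence `g P = g L ∪ (g b + g L) ⊆ P` (`g b ∈ P`).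
Applied to `g⁻¹` (whose cluster hypothesis is the surjectivity hypothesis of `g`) this gives the
converse inclusion.  Sources: Conway–Sloane, SPLAG Ch. 1 §1.3 (hcp as `L ∪ (L + b)`). [folklore]
-/

noncomputable section

namespace Summit.AtomisticToContinuum.Crystallization.Theorems.ExcessDecayLiouvilleCoarseGrains

open Literature.MathematicalPhysics.StatisticalMechanics
open Literature.Algebra.EuclideanLattices (inner_fin_three norm_sq_fin_three)

/-! ## Coordinates in `ℝ³` (`norm_sq_fin_three`, `inner_fin_three` of `FccBccLattices.lean`) -/

/-- A coordinate bound on the norm: `x₀² + x₁² + x₂² ≤ r²`, `0 ≤ r` give `‖x‖ ≤ r`. [folklore] -/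
theorem keyRig_norm_le {x : EuclideanSpace ℝ (Fin 3)} {r : ℝ} (hr : 0 ≤ r)
    (hx : x 0 ^ 2 + x 1 ^ 2 + x 2 ^ 2 ≤ r ^ 2) : ‖x‖ ≤ r :=
  (pow_le_pow_iff_left₀ (norm_nonneg x) hr two_ne_zero).1 (by rwa [norm_sq_fin_three])

/-! ## The even sublattice of hcp -/

/-- `u = barlowPos 0 1 0`. [folklore] -/
theorem keyRig_barlowPos_zero_one_zero (a h : ℝ) :
    barlowPos a h alternatingHagg 0 1 0 = triangularVec₁ a := by
  simp [barlowPos]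

/-- `v = barlowPos 0 0 1`. [folklore] -/
theorem keyRig_barlowPos_zero_zero_one (a h : ℝ) :
    barlowPos a h alternatingHagg 0 0 1 = triangularVec₂ a := by
  simp [barlowPos]

/-- Even-layer points are `i u + j v + k h e₃` (no lateral offset). [folklore] -/
theorem keyRig_barlowPos_of_even (a h : ℝ) {k : ℤ} (hk : Even k) (i j : ℤ) :
    barlowPos a h alternatingHagg k i j =
      (i : ℝ) • triangularVec₁ a + (j : ℝ) • triangularVec₂ a + (k : ℝ) • layerNormal h := by
  simp [barlowPos, haggLabel_alternating_of_even hk]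

/-- In particular `barlowPos k 0 0 = k h e₃` for even `k`. [folklore] -/
theorem keyRig_barlowPos_even_zero_zero (a h : ℝ) {k : ℤ} (hk : Even k) :
    barlowPos a h alternatingHagg k 0 0 = (k : ℝ) • layerNormal h := by
  simp [keyRig_barlowPos_of_even a h hk]

/-- Integer multiples of even-layer points: `n • barlowPos k i j = barlowPos (nk) (ni) (nj)`.
[folklore] -/
theorem keyRig_smul_barlowPos_of_even (a h : ℝ) {k : ℤ} (hk : Even k) (n i j : ℤ) :
    (n : ℝ) • barlowPos a h alternatingHagg k i j =
      barlowPos a h alternatingHagg (n * k) (n * i) (n * j) := by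
  rw [keyRig_barlowPos_of_even a h hk, keyRig_barlowPos_of_even a h (hk.mul_left n)]
  push_cast
  module

/-- **Parity trick**: if `2 • barlowPos k i j` is again a point of hcp then `k` is even (the second
coordinate of an odd-layer point is `a√3/2 · (j + 1/3)`, whose double is never `a√3/2 · j'`).
[folklore] -/
theorem keyRig_even_of_two_smul_mem {a h : ℝ} (ha : a ≠ 0) (hh : h ≠ 0) {k i j : ℤ}
    (h2 : (2 : ℝ) • barlowPos a h alternatingHagg k i j ∈ hcpStacking a h) : Even k := by
  by_contra hodd
  rw [Int.not_even_iff_odd] at hodd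
  obtain ⟨k', i', j', e⟩ := h2
  have e2 := congrArg (fun x : EuclideanSpace ℝ (Fin 3) => x 2) e
  simp only [PiLp.smul_apply, smul_eq_mul, barlowPos_apply_two] at e2
  have hk' : (k' : ℝ) = 2 * k := mul_right_cancel₀ hh (by linarith)
  have hk'ℤ : k' = 2 * k := by exact_mod_cast hk'
  have hev : Even k' := ⟨k, by rw [hk'ℤ, two_mul]⟩
  have e1 := congrArg (fun x : EuclideanSpace ℝ (Fin 3) => x 1) e
  simp only [PiLp.smul_apply, smul_eq_mul, barlowPos_apply_one, haggLabel_alternating_of_odd hodd,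
    haggLabel_alternating_of_even hev, Int.cast_one, Int.cast_zero, zero_div, add_zero] at e1
  have h3 : a * √3 / 2 ≠ 0 := div_ne_zero (mul_ne_zero ha (by positivity)) two_ne_zero
  have e1' : (2 : ℝ) * (j + 1 / 3) = j' := by
    apply mul_left_cancel₀ h3
    linarith
  have e1ℤ : 6 * j + 2 = 3 * j' := by
    have : (6 * j + 2 : ℝ) = 3 * j' := by linarith
    exact_mod_cast this
  omega

/-- Even-layer points of norm `< 2h` lie in layer `0`. [folklore] -/
theorem keyRig_eq_zero_of_norm_lt {a h : ℝ} (hh : 0 < h) {k i j : ℤ} (hk : Even k)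
    (hlt : ‖barlowPos a h alternatingHagg k i j‖ < 2 * h) : k = 0 := by
  have h1 := PiLp.norm_apply_le (barlowPos a h alternatingHagg k i j) 2
  rw [barlowPos_apply_two, Real.norm_eq_abs, abs_mul, abs_of_pos hh] at h1
  have h2 : |(k : ℝ)| < 2 := lt_of_mul_lt_mul_right (by linarith) hh.le
  have h3 : |k| < 2 := by exact_mod_cast h2
  obtain ⟨m, rfl⟩ := hk
  rw [abs_lt] at h3
  omega

/-! ## The layer generators and the normal direction -/

/-- `‖u‖² = a²`. [folklore] -/
theorem keyRig_norm_sq_triangularVec₁ (a : ℝ) : ‖triangularVec₁ a‖ ^ 2 = a ^ 2 := by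
  rw [norm_sq_fin_three]
  simp [triangularVec₁]

/-- `‖v‖² = a²`. [folklore] -/
theorem keyRig_norm_sq_triangularVec₂ (a : ℝ) : ‖triangularVec₂ a‖ ^ 2 = a ^ 2 := by
  have h3 : (√3 : ℝ) ^ 2 = 3 := Real.sq_sqrt (by norm_num)
  rw [norm_sq_fin_three]
  simp only [triangularVec₂, PiLp.toLp_apply, Matrix.cons_val_zero, Matrix.cons_val_one,
    Matrix.cons_val]
  linear_combination (a ^ 2 / 4) * h3

/-- `⟪u, v⟫ = a²/2`. [folklore] -/
theorem keyRig_inner_triangularVec (a : ℝ) :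
    inner ℝ (triangularVec₁ a) (triangularVec₂ a) = a ^ 2 / 2 := by
  rw [inner_fin_three]
  simp only [triangularVec₁, triangularVec₂, PiLp.toLp_apply, Matrix.cons_val_zero,
    Matrix.cons_val_one, Matrix.cons_val]
  ring

/-- `⟪h e₃, u⟫ = 0`. [folklore] -/
theorem keyRig_inner_layerNormal_triangularVec₁ (a h : ℝ) :
    inner ℝ (layerNormal h) (triangularVec₁ a) = 0 := by
  rw [inner_fin_three]
  simp [triangularVec₁, layerNormal]

/-- `⟪h e₃, v⟫ = 0`. [folklore] -/
theorem keyRig_inner_layerNormal_triangularVec₂ (a h : ℝ) :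
    inner ℝ (layerNormal h) (triangularVec₂ a) = 0 := by
  rw [inner_fin_three]
  simp [triangularVec₂, layerNormal]

/-- `‖h e₃‖² = h²`. [folklore] -/
theorem keyRig_norm_sq_layerNormal (h : ℝ) : ‖layerNormal h‖ ^ 2 = h ^ 2 := by
  rw [norm_sq_fin_three]
  simp [layerNormal]

/-- **The normal direction is preserved up to sign**: a linear isometry of `ℝ³` mapping the two
layer generators `u, v` (`a ≠ 0`) into the plane `x₂ = 0` maps `h e₃` to `± h e₃` (the images
still span the plane, by the Lagrange identity `(u₀v₁ − u₁v₀)² = ‖u‖²‖v‖² − ⟪u,v⟫² = 3a⁴/4 ≠ 0`).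
[folklore] -/
theorem keyRig_map_layerNormal {a : ℝ} (ha : a ≠ 0) (h : ℝ)
    (g : EuclideanSpace ℝ (Fin 3) →ₗᵢ[ℝ] EuclideanSpace ℝ (Fin 3))
    (hu : g (triangularVec₁ a) 2 = 0) (hv : g (triangularVec₂ a) 2 = 0) :
    g (layerNormal h) = layerNormal h ∨ g (layerNormal h) = -layerNormal h := by
  have n1 : ‖g (triangularVec₁ a)‖ ^ 2 = a ^ 2 := by
    rw [LinearIsometry.norm_map, keyRig_norm_sq_triangularVec₁]
  have n2 : ‖g (triangularVec₂ a)‖ ^ 2 = a ^ 2 := by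
    rw [LinearIsometry.norm_map, keyRig_norm_sq_triangularVec₂]
  have n3 : ‖g (layerNormal h)‖ ^ 2 = h ^ 2 := by
    rw [LinearIsometry.norm_map, keyRig_norm_sq_layerNormal]
  have i1 : inner ℝ (g (layerNormal h)) (g (triangularVec₁ a)) = 0 := by
    rw [LinearIsometry.inner_map_map, keyRig_inner_layerNormal_triangularVec₁]
  have i2 : inner ℝ (g (layerNormal h)) (g (triangularVec₂ a)) = 0 := by
    rw [LinearIsometry.inner_map_map, keyRig_inner_layerNormal_triangularVec₂]
  have i3 : inner ℝ (g (triangularVec₁ a)) (g (triangularVec₂ a)) = a ^ 2 / 2 := by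
    rw [LinearIsometry.inner_map_map, keyRig_inner_triangularVec]
  rw [norm_sq_fin_three] at n1 n2 n3
  rw [inner_fin_three] at i1 i2 i3
  rw [hu] at n1 i1 i3
  rw [hv] at n2 i2 i3
  set U := g (triangularVec₁ a)
  set V := g (triangularVec₂ a)
  set N := g (layerNormal h)
  have hD : (U 0 * V 1 - U 1 * V 0) ^ 2 = 3 * a ^ 4 / 4 := by
    linear_combination (V 0 ^ 2 + V 1 ^ 2) * n1 + a ^ 2 * n2 -
      (U 0 * V 0 + U 1 * V 1 + a ^ 2 / 2) * i3
  have hD0 : U 0 * V 1 - U 1 * V 0 ≠ 0 := by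
    intro h0
    rw [h0] at hD
    have : a ^ 4 = 0 := by linarith
    exact pow_ne_zero 4 ha this
  have hN0 : N 0 = 0 := by
    have : N 0 * (U 0 * V 1 - U 1 * V 0) = 0 := by linear_combination V 1 * i1 - U 1 * i2
    exact (mul_eq_zero.1 this).resolve_right hD0
  have hN1 : N 1 = 0 := by
    have : N 1 * (U 0 * V 1 - U 1 * V 0) = 0 := by linear_combination U 0 * i2 - V 0 * i1
    exact (mul_eq_zero.1 this).resolve_right hD0
  have hN2 : N 2 = h ∨ N 2 = -h := by
    apply sq_eq_sq_iff_eq_or_eq_neg.1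
    linear_combination n3 - N 0 * hN0 - N 1 * hN1
  rcases hN2 with h2 | h2
  · left
    ext l
    fin_cases l <;> simp [layerNormal, hN0, hN1, h2]
  · right
    ext l
    fin_cases l <;> simp [layerNormal, hN0, hN1, h2]

/-! ## The images of the even layers -/

/-- Even-layer points of the radius-`5/4` cluster are mapped to even-layer points, by the parity
trick applied to their doubles (which are still in the radius-`5/2` cluster). [folklore] -/
theorem keyRig_even_image {a h : ℝ} (ha : a ≠ 0) (hh : h ≠ 0)
    (g : EuclideanSpace ℝ (Fin 3) →ₗᵢ[ℝ] EuclideanSpace ℝ (Fin 3))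
    (hg : ∀ p ∈ hcpStacking a h, ‖p‖ ≤ 5 / 2 → g p ∈ hcpStacking a h)
    {k : ℤ} (hk : Even k) {i j : ℤ} (hsmall : ‖barlowPos a h alternatingHagg k i j‖ ≤ 5 / 4) :
    ∃ k' i' j' : ℤ, Even k' ∧
      g (barlowPos a h alternatingHagg k i j) = barlowPos a h alternatingHagg k' i' j' := by
  obtain ⟨k', i', j', e⟩ := hg _ ⟨k, i, j, rfl⟩ (by linarith)
  refine ⟨k', i', j', keyRig_even_of_two_smul_mem ha hh (k := k') (i := i') (j := j') ?_, e⟩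
  have h2 : (2 : ℝ) • barlowPos a h alternatingHagg k i j =
      barlowPos a h alternatingHagg (k + k) (i + i) (j + j) := by
    rw [two_smul, hcp_add_of_even a h hk]
  have hmem := hg _ ⟨k + k, i + i, j + j, rfl⟩ (by
    rw [← h2, norm_smul, Real.norm_ofNat]
    linarith)
  rwa [← h2, LinearIsometry.map_smul, e] at hmem

/-- **Core**: a linear isometry mapping the radius-`5/2` cluster of `hcp(a,h)` into `hcp(a,h)`
(`0 < a ≤ 1`, `a < 2h`) maps every even-layer point to an even-layer point. [folklore] -/
theorem keyRig_core {a h : ℝ} (ha0 : 0 < a) (ha1 : a ≤ 1) (hah : a < 2 * h)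
    (g : EuclideanSpace ℝ (Fin 3) →ₗᵢ[ℝ] EuclideanSpace ℝ (Fin 3))
    (hg : ∀ p ∈ hcpStacking a h, ‖p‖ ≤ 5 / 2 → g p ∈ hcpStacking a h)
    {k : ℤ} (hk : Even k) (i j : ℤ) :
    ∃ k' i' j' : ℤ, Even k' ∧
      g (barlowPos a h alternatingHagg k i j) = barlowPos a h alternatingHagg k' i' j' := by
  have hh0 : 0 < h := by linarith
  have ha : a ≠ 0 := ha0.ne'
  have hnu : ‖triangularVec₁ a‖ = a :=
    (pow_left_inj₀ (norm_nonneg _) ha0.le two_ne_zero).1 (keyRig_norm_sq_triangularVec₁ a)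
  have hnv : ‖triangularVec₂ a‖ = a :=
    (pow_left_inj₀ (norm_nonneg _) ha0.le two_ne_zero).1 (keyRig_norm_sq_triangularVec₂ a)
  obtain ⟨k₁, i₁, j₁, hk₁, hgu⟩ := keyRig_even_image ha hh0.ne' g hg Even.zero (i := 1) (j := 0)
    (by rw [keyRig_barlowPos_zero_one_zero, hnu]; linarith)
  obtain ⟨k₂, i₂, j₂, hk₂, hgv⟩ := keyRig_even_image ha hh0.ne' g hg Even.zero (i := 0) (j := 1)
    (by rw [keyRig_barlowPos_zero_zero_one, hnv]; linarith)
  rw [keyRig_barlowPos_zero_one_zero] at hgu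
  rw [keyRig_barlowPos_zero_zero_one] at hgv
  obtain rfl : k₁ = 0 := keyRig_eq_zero_of_norm_lt hh0 hk₁
    (by rw [← hgu, LinearIsometry.norm_map, hnu]; exact hah)
  obtain rfl : k₂ = 0 := keyRig_eq_zero_of_norm_lt hh0 hk₂
    (by rw [← hgv, LinearIsometry.norm_map, hnv]; exact hah)
  have hu2 : g (triangularVec₁ a) 2 = 0 := by rw [hgu, barlowPos_apply_two]; simp
  have hv2 : g (triangularVec₂ a) 2 = 0 := by rw [hgv, barlowPos_apply_two]; simp
  have hsum : (i : ℝ) • g (triangularVec₁ a) + (j : ℝ) • g (triangularVec₂ a) =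
      barlowPos a h alternatingHagg 0 (i * i₁ + j * i₂) (i * j₁ + j * j₂) := by
    rw [hgu, hgv, keyRig_smul_barlowPos_of_even a h Even.zero,
      keyRig_smul_barlowPos_of_even a h Even.zero, mul_zero, mul_zero,
      hcp_add_of_even a h Even.zero, add_zero]
  rcases keyRig_map_layerNormal ha h g hu2 hv2 with he | he
  · refine ⟨k, i * i₁ + j * i₂, i * j₁ + j * j₂, hk, ?_⟩
    rw [keyRig_barlowPos_of_even a h hk, g.map_add, g.map_add, g.map_smul, g.map_smul, g.map_smul,
      he, hsum, ← keyRig_barlowPos_even_zero_zero a h hk, hcp_add_of_even a h Even.zero,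
      zero_add, add_zero, add_zero]
  · refine ⟨-k, i * i₁ + j * i₂, i * j₁ + j * j₂, hk.neg, ?_⟩
    rw [keyRig_barlowPos_of_even a h hk, g.map_add, g.map_add, g.map_smul, g.map_smul, g.map_smul,
      he, hsum, smul_neg, ← neg_smul, ← Int.cast_neg, ← keyRig_barlowPos_even_zero_zero a h hk.neg,
      hcp_add_of_even a h Even.zero, zero_add, add_zero, add_zero]

/-- **`g` maps hcp into hcp**: by the core, `g L ⊆ L` for the even layers `L`; the odd layers are
`b + L` with `b = barlowPos 1 0 0` in the cluster, so `g (b + L) = g b + g L ⊆ P + L = P`.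
[folklore] -/
theorem keyRig_mapsTo {a h : ℝ} (ha0 : 0 < a) (ha1 : a ≤ 1) (hah : a < 2 * h) (hh1 : h ≤ 1)
    (g : EuclideanSpace ℝ (Fin 3) →ₗᵢ[ℝ] EuclideanSpace ℝ (Fin 3))
    (hg : ∀ p ∈ hcpStacking a h, ‖p‖ ≤ 5 / 2 → g p ∈ hcpStacking a h)
    {p : EuclideanSpace ℝ (Fin 3)} (hp : p ∈ hcpStacking a h) : g p ∈ hcpStacking a h := by
  obtain ⟨k, i, j, rfl⟩ := hp
  rcases Int.even_or_odd k with hk | hk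
  · obtain ⟨k', i', j', -, e⟩ := keyRig_core ha0 ha1 hah g hg hk i j
    exact ⟨k', i', j', e⟩
  · have hk1 : Even (k - 1) := hk.sub_odd odd_one
    have hsplit : barlowPos a h alternatingHagg k i j =
        barlowPos a h alternatingHagg (k - 1) i j + barlowPos a h alternatingHagg 1 0 0 := by
      rw [hcp_add_of_even a h hk1, sub_add_cancel, add_zero, add_zero]
    have h3 : (√3 : ℝ) ^ 2 = 3 := Real.sq_sqrt (by norm_num)
    have hh0 : 0 < h := by linarith
    obtain ⟨k₀, i₀, j₀, hgb⟩ := hg _ ⟨1, 0, 0, rfl⟩ (by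
      apply keyRig_norm_le (by norm_num)
      simp only [barlowPos_apply_zero, barlowPos_apply_one, barlowPos_apply_two,
        haggLabel_alternating_of_odd odd_one, Int.cast_zero, Int.cast_one]
      nlinarith [h3, mul_pos ha0 ha0, mul_pos hh0 hh0])
    obtain ⟨k', i', j', hk', e⟩ := keyRig_core ha0 ha1 hah g hg hk1 i j
    refine ⟨k' + k₀, i' + i₀, j' + j₀, ?_⟩
    rw [hsplit, g.map_add, e, hgb, hcp_add_of_even a h hk']

/-- **Stub D — rigidity of the radius-`5/2` cluster of hcp.**  For `(a, h)` in the box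
`47/50 ≤ a ≤ 1`, `39/50·a ≤ h ≤ 17/20·a`, a linear isometry `g` of `ℝ³` with
`g (P ∩ B̄(0, 5/2)) ⊆ P` and `P ∩ B̄(0, 5/2) ⊆ g P`, `P = hcp(a,h)`, satisfies `p ∈ P ↔ g p ∈ P`.
Proof: `keyRig_mapsTo` for `g` and for `g⁻¹` (parity trick `n ∈ L ⇔ 2n ∈ P`; no enumeration of
the point group `D_{3h}`).  Conway–Sloane, SPLAG Ch. 1 §1.3. [folklore] -/
theorem stub_keyRigidity :
    ∀ (a h : ℝ) (ha : a ≠ 0) (hh : h ≠ 0), 47 / 50 ≤ a → a ≤ 1 → 39 / 50 * a ≤ h → h ≤ 17 / 20 * a →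
    ∀ g : EuclideanSpace ℝ (Fin 3) →ₗᵢ[ℝ] EuclideanSpace ℝ (Fin 3),
      (∀ p ∈ (hcpPeriodicConfiguration ha hh).points, ‖p‖ ≤ 5 / 2 →
        g p ∈ (hcpPeriodicConfiguration ha hh).points) →
      (∀ p ∈ (hcpPeriodicConfiguration ha hh).points, ‖p‖ ≤ 5 / 2 →
        ∃ q ∈ (hcpPeriodicConfiguration ha hh).points, g q = p) →
      ∀ p, p ∈ (hcpPeriodicConfiguration ha hh).points ↔ g p ∈ (hcpPeriodicConfiguration ha hh).points
 := by
  intro a h ha hh ha₁ ha₂ hh₁ hh₂ g h1 h2 p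
  rw [hcpPeriodicConfiguration_points] at h1 h2 ⊢
  have ha0 : 0 < a := by linarith
  have hah : a < 2 * h := by linarith
  have hh1 : h ≤ 1 := by linarith
  refine ⟨fun hp => keyRig_mapsTo ha0 ha₂ hah hh1 g h1 hp, fun hgp => ?_⟩
  set G := g.toLinearIsometryEquiv rfl
  have hGs : ∀ q ∈ hcpStacking a h, ‖q‖ ≤ 5 / 2 →
      G.symm.toLinearIsometry q ∈ hcpStacking a h := by
    intro q hq hqn
    obtain ⟨r, hr, hgr⟩ := h2 q hq hqn
    have hq' : q = G r := hgr.symm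
    rw [LinearIsometryEquiv.coe_toLinearIsometry, hq', LinearIsometryEquiv.symm_apply_apply]
    exact hr
  have key := keyRig_mapsTo ha0 ha₂ hah hh1 G.symm.toLinearIsometry hGs hgp
  have hgp' : g p = G p := rfl
  rwa [LinearIsometryEquiv.coe_toLinearIsometry, hgp', LinearIsometryEquiv.symm_apply_apply] at key

end Summit.AtomisticToContinuum.Crystallization.Theorems.ExcessDecayLiouvilleCoarseGrains

end
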